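import Mathlib
import Summits.ValiantsHypothesis.ValiantsHypothesis.Theorems.LacunarySymmetroidMatrixDescartesInertiaIndexFormula
import Summits.ValiantsHypothesis.ValiantsHypothesis.Theorems.LacunarySymmetroidMatrixDescartesDetMultiplicityNeutral

/-!
# `MatrixDescartes` (stmt-ValiantsHypothesis-18050) — INERTIA KIT, IV-k: TYPE = STEP at a simple root — a SIMPLE root of `det F` is of
# definite type, and its type is read off the inertia walk: `ν` steps UP by one across a negative-type root and DOWN by one across a
# positive-type root; every symmetric lacunary pencil, every format

HONEST FRAMING.  Cell `pub-symmetroid`, seat `val-sym-mdr-p2` (gen 17); helper file `--supports` the crux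
`Theses.LacunarySymmetroid.MatrixDescartes`, NO closure claim.  The kernel backing of the census-side TYPE-WALK instrument
(`exp/typewalk.py` of this seat: types of the roots of a record pencil from exact inertias at rational points bracketing one simple root
each).  Nothing here bears on the crux in its window, on `stub_twoSided`, on `DoorA26`/`DoorA34`, registers, or `VP ≠ VNP`.

CONTENT.  `kernel_multiple_of_corank_one` (`rank A + 1 = card ι`, `Av = 0`, `v ≠ 0` ⇒ every kernel vector is a multiple of `v`),
`rayleighPoly_smul_eval_derivative` (`P_{cv}′ = c²·P_v′`), `simple_root_data` (a SIMPLE root `t` of `det F` — `mult_t det F = 1` — with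
kernel vector `v`: `dim ker F(t) = 1`, `P_v′(t) ≠ 0`, by the tree's corank-≤-multiplicity and corank-one double-root criterion), and
**`type_eq_step_of_simple`**: if `a < t < b` are non-singular scales bracketing ONLY the simple root `t`, then EITHER `P_v′(t) < 0` and
`ν(F(b)) = ν(F(a)) + 1`, `π(F(a)) = π(F(b)) + 1` (negative type, `ν` steps up) OR `P_v′(t) > 0` and `ν(F(a)) = ν(F(b)) + 1`,
`π(F(b)) = π(F(a)) + 1` (positive type, `ν` steps down).  So for record pencils with tight sign-change certificates (one simple root per
gap) the type word is the sequence of `ν`-steps between consecutive certificate points. [folklore]; axioms standard; no definitions.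
-/

-- layout Summits/ValiantsHypothesis/ValiantsHypothesis forces the duplicated namespace component
set_option linter.dupNamespace false

namespace Summit.ValiantsHypothesis.ValiantsHypothesis.Theorems.LacunarySymmetroidMatrixDescartes

open Matrix Finset Polynomial
open scoped BigOperators Topology

namespace Inertia

variable {ι : Type} [Fintype ι] [DecidableEq ι]

/-! ## §1 Corank one: the kernel is a line -/

omit [DecidableEq ι] in
/-- **Corank one ⇒ the kernel is spanned by any non-zero kernel vector.** [folklore] -/
theorem kernel_multiple_of_corank_one (A : Matrix ι ι ℝ) (hrank : A.rank + 1 = Fintype.card ι) (v : ι → ℝ) (hv0 : v ≠ 0)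
    (hv : A *ᵥ v = 0) (u : ι → ℝ) (hu : A *ᵥ u = 0) : ∃ c : ℝ, u = c • v := by
  set W : Submodule ℝ (ι → ℝ) := LinearMap.ker A.mulVecLin with hW
  have hvW : v ∈ W := by rw [hW, LinearMap.mem_ker, Matrix.mulVecLin_apply]; exact hv
  have huW : u ∈ W := by rw [hW, LinearMap.mem_ker, Matrix.mulVecLin_apply]; exact hu
  have hfin : Module.finrank ℝ W = 1 := by
    have h1 := LinearMap.finrank_range_add_finrank_ker A.mulVecLin
    rw [Module.finrank_fintype_fun_eq_card] at h1
    have h2 : A.rank = Module.finrank ℝ (LinearMap.range A.mulVecLin) := rfl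
    rw [hW]; omega
  have hv0' : (⟨v, hvW⟩ : W) ≠ 0 := fun h => hv0 (congrArg Subtype.val h)
  obtain ⟨c, hc⟩ := (finrank_eq_one_iff_of_nonzero' (⟨v, hvW⟩ : W) hv0').1 hfin ⟨u, huW⟩
  refine ⟨c, ?_⟩
  have h := congrArg Subtype.val hc
  simp only [SetLike.mk_smul_mk] at h
  exact h.symm

section Pencil

variable {κ : Type} [Fintype κ]

omit [DecidableEq ι] in
/-- Scaling of the Rayleigh polynomial's derivative: `P_{c•v}′(t) = c²·P_v′(t)`. [folklore] -/
theorem rayleighPoly_smul_eval_derivative (d : κ → ℕ) (S : κ → Matrix ι ι ℝ) (v : ι → ℝ) (c t : ℝ) :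
    (derivative (∑ k, C ((c • v) ⬝ᵥ (S k *ᵥ (c • v))) * (X : ℝ[X]) ^ d k)).eval t
      = c ^ 2 * (derivative (∑ k, C (v ⬝ᵥ (S k *ᵥ v)) * (X : ℝ[X]) ^ d k)).eval t := by
  have h : (∑ k, C ((c • v) ⬝ᵥ (S k *ᵥ (c • v))) * (X : ℝ[X]) ^ d k)
      = C (c ^ 2) * ∑ k, C (v ⬝ᵥ (S k *ᵥ v)) * (X : ℝ[X]) ^ d k := by
    rw [Finset.mul_sum]
    refine Finset.sum_congr rfl fun k _ => ?_
    rw [Matrix.mulVec_smul, smul_dotProduct, dotProduct_smul, smul_eq_mul, smul_eq_mul, ← mul_assoc, ← sq, C_mul, mul_assoc]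
  rw [h, derivative_C_mul, eval_mul, eval_C]

/-- **Simple root data.**  If `t` is a SIMPLE root of `det F` (`mult_t = 1`) and `v ≠ 0` is a kernel vector of `F(t)`, then
`dim ker F(t) = 1` and `P_v′(t) ≠ 0`. [folklore] -/
theorem simple_root_data (d : κ → ℕ) (S : κ → Matrix ι ι ℝ) (hS : ∀ k, (S k).IsSymm)
    (hdet : Matrix.det (∑ k, ((X : ℝ[X]) ^ d k) • (S k).map C) ≠ 0) (t : ℝ)
    (hmult : (Matrix.det (∑ k, ((X : ℝ[X]) ^ d k) • (S k).map C)).rootMultiplicity t = 1)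
    (v : ι → ℝ) (hv0 : v ≠ 0) (hv : (∑ k, t ^ d k • S k) *ᵥ v = 0) :
    (∑ k, t ^ d k • S k).rank + 1 = Fintype.card ι ∧
      (derivative (∑ k, C (v ⬝ᵥ (S k *ᵥ v)) * (X : ℝ[X]) ^ d k)).eval t ≠ 0 := by
  -- corank ≥ 1 (kernel vector) and ≤ mult = 1
  have h1 : (∑ k, t ^ d k • S k).rank + 1 ≤ Fintype.card ι :=
    Multiplicity.rank_add_le_of_kernel_family _ (fun _ : Fin 1 => v)
      (by
        rw [Fintype.linearIndependent_iff]
        intro c hc i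
        have h : c 0 • v = 0 := by simpa using hc
        rcases smul_eq_zero.1 h with h | h
        · fin_cases i; exact h
        · exact absurd h hv0)
      (fun _ => hv)
  have h2 : ¬ ((∑ k, t ^ d k • S k).rank + 2 ≤ Fintype.card ι) := by
    intro h
    have := Multiplicity.le_rootMultiplicity_det_pencil_of_rank d S hdet t 2 h
    omega
  have hrank : (∑ k, t ^ d k • S k).rank + 1 = Fintype.card ι := by omega
  refine ⟨hrank, fun hzero => ?_⟩
  have hker : ∀ u : ι → ℝ, (∑ k, t ^ d k • S k) *ᵥ u = 0 → ∃ c : ℝ, u = c • v :=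
    fun u hu => kernel_multiple_of_corank_one _ hrank v hv0 hv u hu
  have h2le := (Multiplicity.two_le_rootMultiplicity_iff_of_corank_one d S hS hdet t v hv0 hv hrank hker).2 hzero
  omega

/-! ## §2 Type = step -/

/-- **TYPE = STEP AT A SIMPLE ROOT.**  `F(X) = ∑ₖ X^{dₖ}Sₖ` real symmetric; `a < t < b` with `F(a)`, `F(b)` non-singular and `t` the
ONLY root of `det F` in `(a, b)`, a SIMPLE one; `v ≠ 0` a kernel vector of `F(t)`.  Then either `P_v′(t) < 0`, `ν(F(b)) = ν(F(a)) + 1`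
and `π(F(a)) = π(F(b)) + 1` (negative type: `ν` steps up), or `0 < P_v′(t)`, `ν(F(a)) = ν(F(b)) + 1` and `π(F(b)) = π(F(a)) + 1`
(positive type: `ν` steps down). [folklore] -/
theorem type_eq_step_of_simple (d : κ → ℕ) (S : κ → Matrix ι ι ℝ) (hS : ∀ k, (S k).IsSymm)
    {a t b : ℝ} (hat : a < t) (htb : t < b) (ha : (∑ k, a ^ d k • S k).det ≠ 0) (hb : (∑ k, b ^ d k • S k).det ≠ 0)
    (honly : ∀ x, a < x → x < b → (∑ k, x ^ d k • S k).det = 0 → x = t)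
    (hmult : (Matrix.det (∑ k, ((X : ℝ[X]) ^ d k) • (S k).map C)).rootMultiplicity t = 1)
    (v : ι → ℝ) (hv0 : v ≠ 0) (hv : (∑ k, t ^ d k • S k) *ᵥ v = 0) :
    ((derivative (∑ k, C (v ⬝ᵥ (S k *ᵥ v)) * (X : ℝ[X]) ^ d k)).eval t < 0 ∧
      Fintype.card {j // (isHermitian_pencil d S hS b).eigenvalues j < 0}
        = Fintype.card {j // (isHermitian_pencil d S hS a).eigenvalues j < 0} + 1 ∧
      Fintype.card {j // 0 < (isHermitian_pencil d S hS a).eigenvalues j}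
        = Fintype.card {j // 0 < (isHermitian_pencil d S hS b).eigenvalues j} + 1) ∨
    (0 < (derivative (∑ k, C (v ⬝ᵥ (S k *ᵥ v)) * (X : ℝ[X]) ^ d k)).eval t ∧
      Fintype.card {j // (isHermitian_pencil d S hS a).eigenvalues j < 0}
        = Fintype.card {j // (isHermitian_pencil d S hS b).eigenvalues j < 0} + 1 ∧
      Fintype.card {j // 0 < (isHermitian_pencil d S hS b).eigenvalues j}
        = Fintype.card {j // 0 < (isHermitian_pencil d S hS a).eigenvalues j} + 1) := by
  classical
  set P := Matrix.det (∑ k, ((X : ℝ[X]) ^ d k) • (S k).map C) with hP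
  have hdet : P ≠ 0 := det_pencil_ne_zero_of_eval d S ha
  obtain ⟨hrank, hne⟩ := simple_root_data d S hS hdet t hmult v hv0 hv
  have hker : ∀ u : ι → ℝ, (∑ k, t ^ d k • S k) *ᵥ u = 0 → ∃ c : ℝ, u = c • v :=
    fun u hu => kernel_multiple_of_corank_one _ hrank v hv0 hv u hu
  -- every kernel vector's Rayleigh derivative has the sign of `P_v′(t)`
  have hsign : ∀ u : ι → ℝ, (∑ k, t ^ d k • S k) *ᵥ u = 0 → u ≠ 0 →
      ∃ c : ℝ, c ≠ 0 ∧ (derivative (∑ k, C (u ⬝ᵥ (S k *ᵥ u)) * (X : ℝ[X]) ^ d k)).eval t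
        = c ^ 2 * (derivative (∑ k, C (v ⬝ᵥ (S k *ᵥ v)) * (X : ℝ[X]) ^ d k)).eval t := by
    intro u hu hu0
    obtain ⟨c, rfl⟩ := hker u hu
    have hc : c ≠ 0 := fun h => hu0 (by rw [h, zero_smul])
    exact ⟨c, hc, rayleighPoly_smul_eval_derivative d S v c t⟩
  -- the window `(a, b)` carries exactly one root with multiplicity
  have hcount : Multiset.card (P.roots.filter (fun x => a < x ∧ x < b)) = 1 := by
    have hfilt : P.roots.toFinset.filter (fun x => a < x ∧ x < b) = {t} := by
      ext x
      simp only [Finset.mem_filter, Multiset.mem_toFinset, Finset.mem_singleton]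
      constructor
      · rintro ⟨hx, h1, h2⟩
        have hr := (mem_roots hdet).1 hx
        rw [IsRoot, DefiniteMoments.eval_det_pencil] at hr
        exact honly x h1 h2 hr
      · intro hx
        rw [hx]
        refine ⟨?_, hat, htb⟩
        rw [mem_roots hdet, IsRoot, DefiniteMoments.eval_det_pencil]
        exact Matrix.exists_mulVec_eq_zero_iff.1 ⟨v, hv0, hv⟩
    have h := sum_corank_eq_card_roots_filter d S hS (fun x => a < x ∧ x < b) (fun x hx u hu hu0 => by
      rw [hfilt, Finset.mem_singleton] at hx
      subst hx
      obtain ⟨c, hc, he⟩ := hsign u hu hu0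
      rw [he]
      exact mul_ne_zero (pow_ne_zero 2 hc) hne)
    rw [← hP, hfilt, Finset.sum_singleton] at h
    rw [← h]
    omega
  rcases lt_or_gt_of_ne hne with hneg | hpos
  · left
    have hw := card_roots_Ioo_add_negIndex_eq_of_negType d S hS (lt_trans hat htb) ha hb (fun x h1 h2 hdx u hu hu0 => by
      have hxt := honly x h1 h2 hdx
      subst hxt
      obtain ⟨c, hc, he⟩ := hsign u hu hu0
      rw [he]
      exact mul_neg_of_pos_of_neg (by positivity) hneg)
    rw [← hP, hcount] at hw
    exact ⟨hneg, by omega, by omega⟩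
  · right
    have hw := card_roots_Ioo_add_negIndex_eq_of_posType d S hS (lt_trans hat htb) ha hb (fun x h1 h2 hdx u hu hu0 => by
      have hxt := honly x h1 h2 hdx
      subst hxt
      obtain ⟨c, hc, he⟩ := hsign u hu hu0
      rw [he]
      exact mul_pos (by positivity) hpos)
    rw [← hP, hcount] at hw
    exact ⟨hpos, by omega, by omega⟩

end Pencil

end Inertia

end Summit.ValiantsHypothesis.ValiantsHypothesis.Theorems.LacunarySymmetroidMatrixDescartes
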